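import Summits.BirchSwinnertonDyer.Rank1Residual.Additive.TameBranchUpperOfRatDvdJoin
import Summits.BirchSwinnertonDyer.Rank1Residual.Additive.GordEvenCongruentPairGVShift
import Summits.BirchSwinnertonDyer.Rank1Residual.Additive.GoodModelKummerOfCoatesGreenberg
import Summits.BirchSwinnertonDyer.Rank1Residual.Additive.GordPartnerTrivialMuZero
import HarnessLib

/-!
# The e346 END-of-ENDs `T-E346-TP`: `BSD(E,p)` on an X4♯(G-ord), `e ∈ {3,4,6}` line-even, `r_an = 0`
# receiver with the μ-ANCHOR `hμ0` of cc-typer-2's END (`TameBranchUpperOfRatDvdJoin`, p299240)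
# DISCHARGED BY COMPOSITION through a congruent X4♯(G-ord) partner — T2b (p299908) + S2-from-R
# (D1, p299158) + Delbourgo 2002 (A) on the partner + the partner's `μ = 0`, the latter either an
# OPAQUE binder `hμ₁` (§A) or p02's T3-LIT (§B, `GordPartnerTrivialMuZero`, p300584)
# (cell `b2b-bsdres`, team n1011, seat p07 (gen 9) — row T-E346-TP = r2 ROUTE-2 §II.29.3 / ST-29.1
# ('T2c'); text = r2 GEN 23's kernel-checked scratch `cells/n1011/route2/g23/E346TP_sketch.lean`
# sha16 4f35afff9b6b274a with the T-T3LIT stub replaced by the landed theorem)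

HONEST FRAMING (cell `b2b-bsdres`, run/shared/lean/b2b/bsd-rank1-residual/, verbatim in every
file): the goal of the cell is to DELETE the COMBINATION-SHAPED residual classes of the
Birch–Swinnerton-Dyer formula for ALL analytic-rank `≤ 1` elliptic curves over `ℚ` — "full BSD
formula for every rank `≤ 1` curve in class `C`" assembled STRICTLY from published theorems — so
that the rank-`≤ 1` remainder becomes exactly the CONSTRUCTION-SHAPED classes, which are TYPED
(missing-input `Prop`s), NOT attempted. This is not "finishing BSD". Team n1011 (N10/N11, the
X4♯(G-ord) rows of defect `e ∈ {4, 6}` on the line-even locus): research route; labels and marks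
UNCHANGED; nothing booked; census / instrument output = EVIDENCE, never a Literature fact.
ASSEMBLY theorems only: NO definition, NO named fact, NO new named-fact debt — every PRINTED input
below is ALREADY a binder of the consumed ENDs (`hC`, `hDelA`, `hDelM`, `hDel`, `hGZK`, `hmod` of
p299240; `hGV` of T2b; `hCG` of D1). CONDITIONAL exactly as those files; in particular
`hDelA : Delbourgo2002.mainTheorem` remains a STANDING HYPOTHESIS (registry flag
`Del02-ThmB-ellp-anomalous` carried; lead R5-75 (c)): the five T3-LIT-reachable receivers are EVIDENCE
bookkeeping, nothing booked.

## What and why (r2 §II.29.0 / II.29.3, verbatim in substance)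

With T2b in the tree, the μ-ANCHOR of cc-typer-2's e346 END
`ClassX4Gord.bsdp_rankZero_e346_of_thmC_of_ordinaryTwistPartnerAt_of_mu_zero_of_shaAn_unit` (binder
`hμ0 : ∀ cyclotomic torsion datum D of E, μ(D) = 0`) is DISCHARGEABLE BY COMPOSITION through a
congruent X4♯(G-ord) partner `E₁`: the receiver's `hμ0` is replaced by {`hGV` (A240, Greenberg–Vatsal
2000 §2; producer `…_of_records h23 h414`), `hCG` (Coates–Greenberg 1996 record R, p298348, feeding
S2 via D1), partner class columns `hX₁ hcm₁ h2e₁ he2₁ hodd₁`, the link `hT : TorsionIso W₁ W p`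
[= I1, a `Γ_ℚ`-equivariant `E₁[p] ≃ E[p]`; today EVIDENCE only], and the partner μ-anchor [= T3]}.

* §A `ClassX4Gord.bsdp_rankZero_e346_of_congruentPartner_mu_zero_of_shaAn_unit` — OPAQUE partner
  μ-anchor `hμ₁ : ∀ cyclotomic datum D₁ of E₁, D₁.IsTorsion → D₁.mu = 0` (fed by T3-LIT on the
  literally non-anomalous partners, by p06's T-T3CTL END on 499800el1 ↔ 9800bn1 when it lands, or by
  anything else).  Proof (r2's STEPS): `refine` the END with `?_` at `hμ0`; given a cyclotomic torsion
  datum `D` of `E`, take a dual datum `D₁` of `E₁` (`nonempty_selmerDualData_holds`), its torsion from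
  Delbourgo 2002 (A) (`Delbourgo2002.mainTheorem.isTorsion hDelA`), `Σ₀ :=` the bad places of either
  curve away from `p`, and apply T2b `ClassX4Gord.mu_eq_zero_of_gv_of_s2_of_even` with
  `hS2 := GoodModelLine.imKummer_ge_strictCondition_goodOrdinaryModel_of_coatesGreenberg hCG`.
* §A′ `ClassX4Gord.bsdp_rankZero_five_four_of_congruentPartner_mu_zero_of_shaAn_unit` — the (5;4,4)
  links (the six receivers of record 131100f1, 133350bm1, 233450cr1, 423150da1, 46200dg1, 499800el1):
  the three line conditions on each side are numerals (`decide`).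
* §B `ClassX4Gord.bsdp_rankZero_e346_of_trivialPartner_of_shaAn_unit` — `hμ₁` DISCHARGED from the
  partner's trivial `p`-arithmetic columns {`hr₁ : r_an(E₁) = 0`, `htam₁ : p ∤ ∏ c_ℓ(E₁)`,
  `hL₁ : L(E₁,1)/Ω_{E₁}` a non-zero rational `p`-adic unit, `hbsd₁ : BSDp W₁ p` (census-CLOSED),
  `hna₁ : Delbourgo2002.ReductionNonAnomalous W₁ p` (literal, census NA5_lit)} by p02's T3-LIT
  `partner_mu_eq_zero_of_mainTheorem_of_rankZero` — serves 5 of the 6 receivers (not 499800el1, whose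
  partner 9800bn1 is literal-anomalous: that row takes §A with T-T3CTL).
* §B′ `ClassX4Gord.bsdp_rankZero_five_four_of_trivialPartner_of_shaAn_unit` — (5;4,4) numerals.

WHAT IS NEW: mathematically NOTHING — a composition of landed theorems (r2: "that is the point: the
μ-anchor column of the e346 package is now a NAMED binder set, not a conjecture-shaped `hμ0`").
HONEST PRICE per receiver row: I1 (`TorsionIso` certificate), the census tuple certificate (`h`, `hχ`
— EVIDENCE tier, road census-ctyper1), T3 on the partner, MANIN / Birch × Pal (`hq`, `hu`), and
`ord_p #Ш_an = 0` (`hs`, `hv`). X4♯(G-ord) stays CONSTRUCTION-SHAPED; closes nothing; census −0.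

NOT here: X3♯(G-ord) receivers (the END's integrality `plusSymbolsPIntegralAt_of_classX4` is the
irreducible road), `e = 2`, `p = 3`, mixed-parity links (dead: `GordMixedParityNoMatching`), r_an = 1.

References: D. Delbourgo, J. Number Theory 95 (2002) Thm (A), (B), (C) p. 40 [Delbourgo2002];
D. Delbourgo, Compositio Math. 113 (1998) Prop. 4 p. 144 [Delbourgo1998]; R. Greenberg, V. Vatsal,
Invent. Math. 142 (2000) §2 Prop. (2.8), Cor. (2.3) pp. 26–27 [GreenbergVatsal2000]; J. Coates,
R. Greenberg, Invent. Math. 124 (1996) [CoatesGreenberg1996]; R. Greenberg, LNM 1716 (1999) Prop. 2.4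
[GreenbergLNM1716]; cells/n1011/ROUTE-2.md §II.29; cells/n1011/route2/g23/E346TP_sketch.lean.
-/

set_option autoImplicit false

noncomputable section

open scoped Classical MatrixGroups ModularForm NumberField

open CongruenceSubgroup WeierstrassCurve NumberField IsDedekindDomain Field
  Literature.NumberTheory.EllipticCurves
  Literature.NumberTheory.EllipticCurves.ModularForms
  Literature.NumberTheory.EllipticCurves.Rank1Residual
  Literature.NumberTheory.EllipticCurves.Rank1Residual.Typed
  Literature.NumberTheory.EllipticCurves.Delbourgo2002
  Literature.NumberTheory.EllipticCurves.Greenberg1999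
  Literature.NumberTheory.EllipticCurves.GreenbergVatsal2000
  Literature.NumberTheory.EllipticCurves.CoatesGreenberg1996

namespace Summit.BirchSwinnertonDyer.Rank1Residual.Additive

open Summit.BirchSwinnertonDyer.Rank1Residual.X1.CongruenceTransfer

variable {p : ℕ} [hp : Fact p.Prime] {W₁ W : WeierstrassCurve ℚ} [W₁.IsElliptic] [W₁.IsGloballyMinimal]
  [W.IsElliptic] [W.IsGloballyMinimal]

/-! ### §A The END-of-ENDs with an OPAQUE partner μ-anchor -/

/-- **T-E346-TP (opaque partner form).** X4♯(G-ord) receiver `W` at `p ≥ 5`, `e(W) ∈ {3,4,6}` on the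
even line (`2 ∣ e`, so `e ≠ 2`, `(p-1)/e` odd), non-CM, `r_an = 0`, `ord_p #Ш_an = 0`; X4♯(G-ord)
partner `W₁` on the even line, non-CM, `E₁[p] ≃ E[p]` (`hT`), with `μ(X(E₁/ℚ_∞)) = 0` for every
cyclotomic torsion dual datum (`hμ₁`) ⟹ `BSD(E,p)`. Binders: PRINTED {`hC`, `hDelA`, `hDelM`, `hDel`,
`hGZK`, `hmod`, `hCG` (Coates–Greenberg R)} · TYPED {`hGV` (A240; producer `…_of_records h23 h414`)}
· receiver columns {`hX`, `hp5`, `hcm`, `hr`, `he`, `h2e`, `hodd`} · partner columns {`hX₁`, `hcm₁`,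
`h2e₁`, `he2₁`, `hodd₁`} · link {`hT`} [I1 certificate] · census EVIDENCE {`h`, `hχ`} · partner
μ-anchor {`hμ₁`} [T3] · period binder {`hq`, `hu`} · `#Ш_an` unit {`hs`, `hv`}. A composition of
p299240 ∘ T2b ∘ D1 ∘ Delbourgo 2002 (A); closes nothing by itself; nothing booked.
[cite: Delbourgo2002, Theorem (A), (C) (p. 40)] [cite: Delbourgo1998, Prop. 4 (p. 144)]
[cite: GreenbergVatsal2000, §2 Prop. (2.8) with Remark (2.9), Cor. (2.3), pp. 26–27 (arXiv:math/9906215)] -/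
theorem ClassX4Gord.bsdp_rankZero_e346_of_congruentPartner_mu_zero_of_shaAn_unit
    (hC : Delbourgo2002.thmC_charIdeal_dvd_tameBranch)
    (hDelA : Delbourgo2002.mainTheorem) (hDelM : Delbourgo2002.mainTheorem_potMult)
    (hDel : Delbourgo1998.prop4_rankZero_pow_dvd_constantCoeff)
    (hGZK : rank_eq_analyticRank_of_analyticRank_le_one) (hmod : hasEntireLFunction_rat)
    (hGV : muLambdaAlg_transfer_of_torsionIso_potOrd_of_not_dvd_torsionOrder)
    (hCG : H1_goodModelKernel_trivial.{0})
    -- receiver columns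
    (hX : ClassX4Gord W p) (hp5 : 5 ≤ p) (hcm : ¬ W.HasCM) (hr : W.analyticRank = 0)
    (he : semistabilityIndex W p ∈ ({3, 4, 6} : Finset ℕ))
    (h2e : 2 ∣ semistabilityIndex W p) (hodd : ¬ 2 ∣ (p - 1) / semistabilityIndex W p)
    -- partner columns + link
    (hX₁ : ClassX4Gord W₁ p) (hcm₁ : ¬ W₁.HasCM)
    (h2e₁ : 2 ∣ semistabilityIndex W₁ p) (he2₁ : semistabilityIndex W₁ p ≠ 2)
    (hodd₁ : ¬ 2 ∣ (p - 1) / semistabilityIndex W₁ p)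
    (hT : TorsionIso W₁ W p)
    -- census tuple (EVIDENCE tier)
    (h : CensusX43.OrdinaryTwistPartnerAt W p)
    {N : ℕ} [NeZero N] {f : CuspForm (Gamma0 N) 2} (hf : IsNewformOf W f)
    {χ : MulChar (ZMod p) ℚ_[p]}
    (hχ : CensusX43.IsTeichmullerPow χ (CensusX43.ordinaryTeichmullerExponent W p))
    -- partner μ-anchor (T3)
    (hμ₁ : ∀ (K : ZpExtension ℚ p) (γ : Field.absoluteGaloisGroup ℚ),
      K.IsCyclotomic → K.IsTopGenerator γ → IsCyclotomicVariable p γ →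
      ∀ D₁ : W₁.SelmerDualData K γ, D₁.IsTorsion → D₁.mu = 0)
    -- period binder, #Ш_an
    {q : ℚ} (hq : W.entireLFunction 1 = (q : ℂ) * (W.realPeriodRat : ℂ))
    {u : ℤ_[p]ˣ} (hu : ((ratPlusSymbol f 0 : ℚ) : ℚ_[p]) = ((u : ℤ_[p]) : ℚ_[p]) * (q : ℚ_[p]))
    {s : ℚ} (hs : shaAn W = (s : ℂ)) (hv : padicValRat p s = 0) : BSDp W p := by
  refine ClassX4Gord.bsdp_rankZero_e346_of_thmC_of_ordinaryTwistPartnerAt_of_mu_zero_of_shaAn_unit hC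
    hDelA hDelM hDel hGZK hmod hX hp5 hcm hr he h hf hχ ?_ hq hu hs hv
  intro K γ hK hγ hγ' D hDt
  have he2 : semistabilityIndex W p ≠ 2 := by
    simp only [Finset.mem_insert, Finset.mem_singleton] at he
    omega
  -- the partner's Iwasawa module and its torsion-ness (Delbourgo 2002 (A))
  obtain ⟨D₁⟩ := W₁.nonempty_selmerDualData_holds K γ hγ
  haveI : Module.Finite (IwasawaAlgebra p) D.X := D.module_finite_holds hγ
  haveI : Module.Finite (IwasawaAlgebra p) D₁.X := D₁.module_finite_holds hγ
  have hD₁t : D₁.IsTorsion :=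
    Delbourgo2002.mainTheorem.isTorsion hDelA hp5 hcm₁ hX₁.1.2.1 hX₁.2 hK hγ D₁
  -- Σ₀ := the bad places of either curve away from `p`
  have hf₁ : (W₁.badPlaces (𝓞 ℚ)).Finite := W₁.finite_badPlaces_holds (𝓞 ℚ)
  have hf₂ : (W.badPlaces (𝓞 ℚ)).Finite := W.finite_badPlaces_holds (𝓞 ℚ)
  let S₀ : Finset (HeightOneSpectrum (𝓞 ℚ)) :=
    (hf₁.toFinset ∪ hf₂.toFinset).filter (fun w ↦ ((p : ℕ) : 𝓞 ℚ) ∉ w.asIdeal)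
  have hS₀ : ∀ w ∈ S₀, ((p : ℕ) : 𝓞 ℚ) ∉ w.asIdeal := fun w hw ↦ (Finset.mem_filter.mp hw).2
  have hS₁ : ∀ w : HeightOneSpectrum (𝓞 ℚ), w ∉ S₀ → ((p : ℕ) : 𝓞 ℚ) ∉ w.asIdeal →
      W₁.HasGoodReductionAt w := by
    intro w hw hpw
    by_contra hbad
    exact hw (Finset.mem_filter.mpr
      ⟨Finset.mem_union.mpr (Or.inl (hf₁.mem_toFinset.mpr ((W₁.mem_badPlaces_iff w).mpr hbad))), hpw⟩)
  have hS₂ : ∀ w : HeightOneSpectrum (𝓞 ℚ), w ∉ S₀ → ((p : ℕ) : 𝓞 ℚ) ∉ w.asIdeal →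
      W.HasGoodReductionAt w := by
    intro w hw hpw
    by_contra hbad
    exact hw (Finset.mem_filter.mpr
      ⟨Finset.mem_union.mpr (Or.inr (hf₂.mem_toFinset.mpr ((W.mem_badPlaces_iff w).mpr hbad))), hpw⟩)
  -- T2b (p299908) with S2 := D1 (p299158) from Coates–Greenberg R
  exact ClassX4Gord.mu_eq_zero_of_gv_of_s2_of_even hGV
    (GoodModelLine.imKummer_ge_strictCondition_goodOrdinaryModel_of_coatesGreenberg hCG) hp5 hX₁ hX
    h2e₁ he2₁ hodd₁ h2e he2 hodd hT S₀ hS₀ hS₁ hS₂ hK hγ hγ' D₁ D hD₁t hDt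
    (hμ₁ K γ hK hγ hγ' D₁ hD₁t)

/-- **T-E346-TP at `(5;4,4)`, opaque partner form** — the six receivers of record (131100f1,
133350bm1, 233450cr1, 423150da1, 46200dg1, 499800el1, each with an X4♯(G-ord) `(5;4)` partner): the
line conditions `2 ∣ 4`, `4 ≠ 2`, `¬ 2 ∣ (5-1)/4` are numerals. Closes nothing by itself; nothing booked.
[cite: Delbourgo2002, Theorem (A), (C) (p. 40)] [cite: Delbourgo1998, Prop. 4 (p. 144)]
[cite: GreenbergVatsal2000, §2 Prop. (2.8) with Remark (2.9), Cor. (2.3), pp. 26–27 (arXiv:math/9906215)] -/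
theorem ClassX4Gord.bsdp_rankZero_five_four_of_congruentPartner_mu_zero_of_shaAn_unit (hp5 : p = 5)
    (hC : Delbourgo2002.thmC_charIdeal_dvd_tameBranch)
    (hDelA : Delbourgo2002.mainTheorem) (hDelM : Delbourgo2002.mainTheorem_potMult)
    (hDel : Delbourgo1998.prop4_rankZero_pow_dvd_constantCoeff)
    (hGZK : rank_eq_analyticRank_of_analyticRank_le_one) (hmod : hasEntireLFunction_rat)
    (hGV : muLambdaAlg_transfer_of_torsionIso_potOrd_of_not_dvd_torsionOrder)
    (hCG : H1_goodModelKernel_trivial.{0})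
    (hX : ClassX4Gord W p) (hcm : ¬ W.HasCM) (hr : W.analyticRank = 0)
    (he : semistabilityIndex W p = 4)
    (hX₁ : ClassX4Gord W₁ p) (hcm₁ : ¬ W₁.HasCM) (he₁ : semistabilityIndex W₁ p = 4)
    (hT : TorsionIso W₁ W p)
    (h : CensusX43.OrdinaryTwistPartnerAt W p)
    {N : ℕ} [NeZero N] {f : CuspForm (Gamma0 N) 2} (hf : IsNewformOf W f)
    {χ : MulChar (ZMod p) ℚ_[p]}
    (hχ : CensusX43.IsTeichmullerPow χ (CensusX43.ordinaryTeichmullerExponent W p))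
    (hμ₁ : ∀ (K : ZpExtension ℚ p) (γ : Field.absoluteGaloisGroup ℚ),
      K.IsCyclotomic → K.IsTopGenerator γ → IsCyclotomicVariable p γ →
      ∀ D₁ : W₁.SelmerDualData K γ, D₁.IsTorsion → D₁.mu = 0)
    {q : ℚ} (hq : W.entireLFunction 1 = (q : ℂ) * (W.realPeriodRat : ℂ))
    {u : ℤ_[p]ˣ} (hu : ((ratPlusSymbol f 0 : ℚ) : ℚ_[p]) = ((u : ℤ_[p]) : ℚ_[p]) * (q : ℚ_[p]))
    {s : ℚ} (hs : shaAn W = (s : ℂ)) (hv : padicValRat p s = 0) : BSDp W p := by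
  subst hp5
  exact hX.bsdp_rankZero_e346_of_congruentPartner_mu_zero_of_shaAn_unit hC hDelA hDelM hDel hGZK hmod
    hGV hCG le_rfl hcm hr (by rw [he]; decide) (by rw [he]; decide) (by rw [he]; decide) hX₁ hcm₁
    (by rw [he₁]; decide) (by rw [he₁]; decide) (by rw [he₁]; decide) hT h hf hχ hμ₁ hq hu hs hv

/-! ### §B The partner μ-anchor from trivial `p`-arithmetic: T3-LIT (p02 gen 6, p300584) -/

/-- **T-E346-TP (trivial-partner form, T3 = T3-LIT).** The END-of-ENDs with the partner μ-anchor
DISCHARGED from the partner's trivial `p`-arithmetic columns {`hr₁` (`r_an(E₁) = 0`), `htam₁`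
(`p ∤ ∏ c_ℓ(E₁)`), `hL₁` (`L(E₁,1)/Ω_{E₁}` a non-zero rational `p`-adic unit), `hbsd₁` (`BSD(E₁,p)`,
census-CLOSED), `hna₁` (literal non-anomaly, census NA5_lit)} through p02's
`partner_mu_eq_zero_of_mainTheorem_of_rankZero` (Delbourgo 2002 (A)+(B) at `r = 0`, `ℓ_p = 1`).
Serves 5 of the 6 receivers of record (not 499800el1 ↔ 9800bn1: literal-anomalous partner — §A with
T-T3CTL). Closes nothing by itself; nothing booked.
[cite: Delbourgo2002, Theorem (A), (B), (C) (p. 40), case r_E = 0, ℓ_p(E) = 1 (p. 39)]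
[cite: Delbourgo1998, Prop. 4 (p. 144)]
[cite: GreenbergVatsal2000, §2 Prop. (2.8) with Remark (2.9), Cor. (2.3), pp. 26–27 (arXiv:math/9906215)] -/
theorem ClassX4Gord.bsdp_rankZero_e346_of_trivialPartner_of_shaAn_unit
    (hC : Delbourgo2002.thmC_charIdeal_dvd_tameBranch)
    (hDelA : Delbourgo2002.mainTheorem) (hDelM : Delbourgo2002.mainTheorem_potMult)
    (hDel : Delbourgo1998.prop4_rankZero_pow_dvd_constantCoeff)
    (hGZK : rank_eq_analyticRank_of_analyticRank_le_one) (hmod : hasEntireLFunction_rat)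
    (hGV : muLambdaAlg_transfer_of_torsionIso_potOrd_of_not_dvd_torsionOrder)
    (hCG : H1_goodModelKernel_trivial.{0})
    -- receiver columns
    (hX : ClassX4Gord W p) (hp5 : 5 ≤ p) (hcm : ¬ W.HasCM) (hr : W.analyticRank = 0)
    (he : semistabilityIndex W p ∈ ({3, 4, 6} : Finset ℕ))
    (h2e : 2 ∣ semistabilityIndex W p) (hodd : ¬ 2 ∣ (p - 1) / semistabilityIndex W p)
    -- partner columns + link
    (hX₁ : ClassX4Gord W₁ p) (hcm₁ : ¬ W₁.HasCM)
    (h2e₁ : 2 ∣ semistabilityIndex W₁ p) (he2₁ : semistabilityIndex W₁ p ≠ 2)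
    (hodd₁ : ¬ 2 ∣ (p - 1) / semistabilityIndex W₁ p)
    (hr₁ : W₁.analyticRank = 0) (htam₁ : ¬ p ∣ W₁.tamagawaProduct)
    (hL₁ : ∃ q : ℚ, q ≠ 0 ∧ W₁.entireLFunction 1 / (W₁.realPeriodRat : ℂ) = (q : ℂ) ∧
      padicValRat p q = 0)
    (hbsd₁ : BSDp W₁ p) (hna₁ : Delbourgo2002.ReductionNonAnomalous W₁ p)
    (hT : TorsionIso W₁ W p)
    -- census tuple (EVIDENCE tier)
    (h : CensusX43.OrdinaryTwistPartnerAt W p)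
    {N : ℕ} [NeZero N] {f : CuspForm (Gamma0 N) 2} (hf : IsNewformOf W f)
    {χ : MulChar (ZMod p) ℚ_[p]}
    (hχ : CensusX43.IsTeichmullerPow χ (CensusX43.ordinaryTeichmullerExponent W p))
    -- period binder, #Ш_an
    {q : ℚ} (hq : W.entireLFunction 1 = (q : ℂ) * (W.realPeriodRat : ℂ))
    {u : ℤ_[p]ˣ} (hu : ((ratPlusSymbol f 0 : ℚ) : ℚ_[p]) = ((u : ℤ_[p]) : ℚ_[p]) * (q : ℚ_[p]))
    {s : ℚ} (hs : shaAn W = (s : ℂ)) (hv : padicValRat p s = 0) : BSDp W p :=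
  hX.bsdp_rankZero_e346_of_congruentPartner_mu_zero_of_shaAn_unit hC hDelA hDelM hDel hGZK hmod hGV hCG
    hp5 hcm hr he h2e hodd hX₁ hcm₁ h2e₁ he2₁ hodd₁ hT h hf hχ
    (fun _ _ hK hγ hγ' D₁ _ ↦ (partner_mu_eq_zero_of_mainTheorem_of_rankZero hDelA hGZK hp5 hcm₁ hX₁ hr₁
      htam₁ hL₁ hbsd₁ hna₁ hK hγ hγ' D₁).2) hq hu hs hv

/-- **T-E346-TP at `(5;4,4)`, trivial-partner form** — the five receivers of record with a literally
non-anomalous `(5;4)` partner (131100f1, 133350bm1, 233450cr1, 423150da1, 46200dg1): the line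
conditions are numerals. Closes nothing by itself; nothing booked.
[cite: Delbourgo2002, Theorem (A), (B), (C) (p. 40), case r_E = 0, ℓ_p(E) = 1 (p. 39)]
[cite: Delbourgo1998, Prop. 4 (p. 144)]
[cite: GreenbergVatsal2000, §2 Prop. (2.8) with Remark (2.9), Cor. (2.3), pp. 26–27 (arXiv:math/9906215)] -/
theorem ClassX4Gord.bsdp_rankZero_five_four_of_trivialPartner_of_shaAn_unit (hp5 : p = 5)
    (hC : Delbourgo2002.thmC_charIdeal_dvd_tameBranch)
    (hDelA : Delbourgo2002.mainTheorem) (hDelM : Delbourgo2002.mainTheorem_potMult)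
    (hDel : Delbourgo1998.prop4_rankZero_pow_dvd_constantCoeff)
    (hGZK : rank_eq_analyticRank_of_analyticRank_le_one) (hmod : hasEntireLFunction_rat)
    (hGV : muLambdaAlg_transfer_of_torsionIso_potOrd_of_not_dvd_torsionOrder)
    (hCG : H1_goodModelKernel_trivial.{0})
    (hX : ClassX4Gord W p) (hcm : ¬ W.HasCM) (hr : W.analyticRank = 0)
    (he : semistabilityIndex W p = 4)
    (hX₁ : ClassX4Gord W₁ p) (hcm₁ : ¬ W₁.HasCM) (he₁ : semistabilityIndex W₁ p = 4)
    (hr₁ : W₁.analyticRank = 0) (htam₁ : ¬ p ∣ W₁.tamagawaProduct)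
    (hL₁ : ∃ q : ℚ, q ≠ 0 ∧ W₁.entireLFunction 1 / (W₁.realPeriodRat : ℂ) = (q : ℂ) ∧
      padicValRat p q = 0)
    (hbsd₁ : BSDp W₁ p) (hna₁ : Delbourgo2002.ReductionNonAnomalous W₁ p)
    (hT : TorsionIso W₁ W p)
    (h : CensusX43.OrdinaryTwistPartnerAt W p)
    {N : ℕ} [NeZero N] {f : CuspForm (Gamma0 N) 2} (hf : IsNewformOf W f)
    {χ : MulChar (ZMod p) ℚ_[p]}
    (hχ : CensusX43.IsTeichmullerPow χ (CensusX43.ordinaryTeichmullerExponent W p))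
    {q : ℚ} (hq : W.entireLFunction 1 = (q : ℂ) * (W.realPeriodRat : ℂ))
    {u : ℤ_[p]ˣ} (hu : ((ratPlusSymbol f 0 : ℚ) : ℚ_[p]) = ((u : ℤ_[p]) : ℚ_[p]) * (q : ℚ_[p]))
    {s : ℚ} (hs : shaAn W = (s : ℂ)) (hv : padicValRat p s = 0) : BSDp W p := by
  subst hp5
  exact hX.bsdp_rankZero_e346_of_trivialPartner_of_shaAn_unit hC hDelA hDelM hDel hGZK hmod hGV hCG
    le_rfl hcm hr (by rw [he]; decide) (by rw [he]; decide) (by rw [he]; decide) hX₁ hcm₁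
    (by rw [he₁]; decide) (by rw [he₁]; decide) (by rw [he₁]; decide) hr₁ htam₁ hL₁ hbsd₁ hna₁ hT h hf
    hχ hq hu hs hv

end Summit.BirchSwinnertonDyer.Rank1Residual.Additive

end
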